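/- Copyright: the b2b-balaban cell (near-miss cell 7), T⁴-continuum fan-out; row NE7b CRUX team (2), seat
t4-ne7b-formalise-leaf-03 (gen 26) — custodian's part of the OWNER's INTERFACE REQUESTS NE7b IR-45-1 ∕ IR-46-1 and
RULING R-OWNER-46-1 («THE (α) SUPPLIER PLUG OF `priceM`∕`upM`∕`resumM` OVER M2 BRICK B, FIBRE FORM → S12-W crew (leaf-03
custodian; E-side leaf-02; leaf-05)», HOME/INBOX.md l.8656 ∕ l.8971, `CLAIMS.log` l.31515 ∕ l.31568 ∕ l.31646), the
sibling that JOINS the crew's modules.  Released under the licence of the surrounding project. -/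
import Summits.QuantumFields.BalabanUV.T4Continuum.Support.HistoryRealiseCellsRunSupplyWTVS
import Summits.QuantumFields.BalabanUV.T4Continuum.Support.HistoryRealiseCellsRunSupplyMembers
import Summits.QuantumFields.BalabanUV.T4Continuum.Support.HistoryPriceKeys
import Summits.QuantumFields.BalabanUV.T4Continuum.Support.HistoryBankingFibreCharge
import Summits.QuantumFields.BalabanUV.T4Continuum.Support.HistoryBankingForestPlug

/-!
# M2 brick B → the END's witness, the JUNCTION OF THE CREW's MODULES: `FcM := LIVEOf`, `RfM := MULTOf` (leaf-02's
`HistoryPriceKeys`), the CHARGE from the owner's `RoundingRoomF` (M5-4a `HistoryBankingFibreRoom`), and the fields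
`upM` ∕ `priceM` ∕ `FM_nonneg` ∕ `resumM` of the VS-witness SUPPLIED FROM THE READING with no abstract letter left
(re-open object (α) of row NE7b; IR-45-1 ∕ R-OWNER-46-1 ∕ IR-46-1 (B) «`priceM_of_reading` := B ∘ owner»; lineage
`t4-ne7b-formalise-leaf-03` gen 26, custodian of the S12-W crew)

Summits-side support leaf of the T⁴-continuum cell (rung (B)+1 on a FINITE torus only; NOT infinite volume, NOT the
mass gap, NOT the Clay statement; NOT a proof of the spine estimate NE7b — the cell's OWN estimate, NOT PRINTED, NOT
PROVED).  [folklore] composition BY NAME of: part 2 `HistoryRealiseCellsRunSupplyWTVS` (`upM_of_reading` with the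
abstract live price and its one-sided key reading, `resumM_of_fibreMass`), leaf-02's module B′ `HistoryPriceKeys`
(`liveSharp`, `LIVEOf`, `MULTOf`, `prod_liveC_liveSharp_le_LIVEOf`, `priceM_of_keys_of_charge`), the owner's M5-3b∕M5-4b
(`HistoryBankingCreditRead.evProd_le_exp_neg_sharps`, `HistoryBankingFibreCharge.credits_add_discount_add_fshare_le_sharps`
— the CHARGE with the fibre share booked, under `RoundingRoomF`) and S20∕S21 (`HistoryBankingForestPlug.wf_genT_pedMV`,
`HistoryBankingCreditPlug.consistentTLE_genT_pedMV`); no definition, no `[cite:]` tag, nothing printed asserted, no `Prop`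
fact minted, zero `sorry`.

WHAT.  §1 `evProd_toPGen_le_exp_neg_credits` (M5-3b's bridge in `credits` form) and **`live_le_LIVEOf`**: for any pass-V
input family, M2-B's LIVE product of a term `∏_{x ∈ histV.comp K} e^{lifeCost}·e^{birthWT u}·evProd (fB) (fR) (pedMV.toPGen
id (K,x))` is at most `LIVEOf C K R u (sharpT sB sR) (kmemOf pedV liveCV cellOf phys K τ)` under `FactorRead fB fR sB sR`,
members well formed, distinct root cells — the one-sided key reading `hFcM` of part 2 DISCHARGED at the owner's amended
`FcM := LIVE♯` (W-ne7bp1-g46-3).  §2 over M2-B's reading `ℛ` (`T := termSet I`, `ped := ℛ.inputOf.pedV`,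
`liveC := ℛ.inputOf.liveCV`, any `cellOf`∕`phys` with distinct root cells): `wf_genT_pedV_inputOf`,
`consistentTLE_genT_pedV_inputOf` (S20∕S21 per term), **`upM_of_reading'`** (part 2's `upM_of_reading` at
`FcM K := LIVEOf C K (ℛ.R K) (uV K) (sharpT sB sR)`, no `hFcM` left), **`FM_nonneg_of_reading`**, **`priceM_of_reading`**
(the field `priceM` of `CountRoadWitnessT3bWTVS` at `FcM := LIVEOf …`, `RfM := MULTOf (sharpT φB φR)`, from `FactorRead` +
`RoundingRoomF` + (2.9) + the pass-V process conditions per term: B′'s `priceM_of_keys_of_charge` ∘ M5-4b's charge),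
**`resumM_of_reading`** (part 2's `resumM_of_fibreMass` at `MULT := MULTOf (sharpT φB φR)`: the located display (ρ)
`FibreMass` ⇒ `resumM`).

HONEST SCOPE.  Every display stays a HYPOTHESIS (R-class): `HistRead`, the pass-V process conditions, the volume
calibrations, `FactorRead`, `RoundingRoomF`, `FlowIneq29`, `W` ∕ `W∞`, (ρ) `FibreMass`, `Set.InjOn cellOf`
(`cellOfR_injOn_W` at assembly).  BY-NAME EFFECT ON THE WALL (WALL-NE7b-P1 v1.20 row S22): the VS-witness's `upM`,
`deadM_nonneg`, `FM_nonneg`, `priceM` are KERNEL modulo the located displays for run A's reading (run B verbatim at its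
own reading); `resumM` is R AS the located display (ρ) + `W∞`; `reprA`∕`reprB`, `realised`'s identification, the
(γ)∕NE7∕NE7c fields untouched.  NE7b NOT proved; spine 0∕9.  HONEST DEPENDENCY (cell): continuum YM on T⁴ ⇐ BetaPertH ∧
nine spine estimates (0/9 proved); BetaPertH ⇐ (D1) ∧ (D4) ∧ CAP+tail; G-an2-4 gates asym, D1 and NE2/3/4.  This file
changes none of it.
-/

open Finset MeasureTheory
open Literature.MathematicalPhysics.QuantumFieldTheory.Balaban1983to89
open Literature.MathematicalPhysics.QuantumFieldTheory.Balaban1983to89.B13ScaleTransfer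
open Literature.MathematicalPhysics.QuantumFieldTheory.Balaban1983to89.B16SProfile
open T4PersistenceDictionary T4PrintedShapeBanking T4TaggedShapeBanking T4BankedInduction T4PartnerMultiplicity
open T4LiveClassFibration T4BranchingRecordsGas
open Summit.QuantumFields.BalabanUV.T4Continuum.ZoneSkeleton
open Summit.QuantumFields.BalabanUV.T4Continuum.HistoryAdmissible
open Summit.QuantumFields.BalabanUV.T4Continuum.HistoryGen
open Summit.QuantumFields.BalabanUV.T4Continuum.HistoryGenealogyExtraction
open Summit.QuantumFields.BalabanUV.T4Continuum.HistoryGenealogyRealise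
open Summit.QuantumFields.BalabanUV.T4Continuum.HistoryGenealogyInstantiate
open Summit.QuantumFields.BalabanUV.T4Continuum.HistoryGenealogyPedigree
open Summit.QuantumFields.BalabanUV.T4Continuum.B16HistoryIndexedRepr
open Summit.QuantumFields.BalabanUV.T4Continuum.HistoryBankingLE
open Summit.QuantumFields.BalabanUV.T4Continuum.HistoryConstants
open Summit.QuantumFields.BalabanUV.T4Continuum.HistoryBankingForestVolume
open Summit.QuantumFields.BalabanUV.T4Continuum.HistoryBankingVolumePlug
open Summit.QuantumFields.BalabanUV.T4Continuum.HistoryBankingForestPlug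
open Summit.QuantumFields.BalabanUV.T4Continuum.HistoryBankingDiscountCharge
open Summit.QuantumFields.BalabanUV.T4Continuum.HistoryBankingCreditRead
open Summit.QuantumFields.BalabanUV.T4Continuum.HistoryBankingCreditPlug
open Summit.QuantumFields.BalabanUV.T4Continuum.HistoryBankingFibreRoom
open Summit.QuantumFields.BalabanUV.T4Continuum.HistoryBankingFibreCharge
open Summit.QuantumFields.BalabanUV.T4Continuum.B16HistoryWeightPlug
open Summit.QuantumFields.BalabanUV.T4Continuum.HistoryAssemblyTerms
open Summit.QuantumFields.BalabanUV.T4Continuum.HistoryAssemblyPedigree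
open Summit.QuantumFields.BalabanUV.T4Continuum.HistoryAssemblyMult
open Summit.QuantumFields.BalabanUV.T4Continuum.HistoryAssemblyMultKey
open Summit.QuantumFields.BalabanUV.T4Continuum.HistoryPriceNodeSum
open Summit.QuantumFields.BalabanUV.T4Continuum.HistoryPriceKeys
open Summit.QuantumFields.BalabanUV.T4Continuum.HistoryRealiseCellsRunSupplyMembers
open Summit.QuantumFields.BalabanUV.T4Continuum.HistoryRealiseCellsRunSupplyWTVS

namespace Summit.QuantumFields.BalabanUV.T4Continuum.HistoryRealiseCellsRunSupplyKeysWTVS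

noncomputable section

-- the structural `DecidableEq` instance of the concrete tag type exceeds the default synthesis size (as in the
-- siblings `B16HistoryWeightPlug` ∕ `B16HistoryPricePlug`)
set_option synthInstance.maxSize 1024

/-! ## §1 M2-B's LIVE product of a term is at most the key family's `LIVEOf` at the sharp table -/

section Live

variable {α π γ : Type*} [DecidableEq α] [DecidableEq π] [Inhabited γ] {fB : ℕ → ℕ → γ → ℝ} {fR : ℕ → ℝ}
  {sB : ℕ → ℕ → ℝ} {sR : ℕ → ℝ}

/-- M5-3b's bridge in `credits` form: `evProd fB fR (Pd.toPGen cell c) ≤ exp (−credits (sharpT sB sR ∘ Prod.fst) (Pd.genT c))`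
for a renewal-dated pedigree and a well-formed member (any table). [folklore] -/
theorem evProd_toPGen_le_exp_neg_credits (hF : FactorRead fB fR sB sR) (Pd : Pedigree α π) (cell : π → γ)
    (hS : ∀ c c', Part.old c' true ∈ Pd.parts c → Pd.step c' + 1 = Pd.step c) (c : α) {W : Lab α π → ℕ}
    (hW : (Pd.genT c).WF W) :
    evProd fB fR (Pd.toPGen cell c) ≤ Real.exp (-credits (sharpT sB sR ∘ Prod.fst) (Pd.genT c)) := by
  have hb := evProd_le_exp_neg_sharps (shape ∘ Prod.fst) hF (Pd.toPGen cell c) (Pd.genT c)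
    (Pd.shape_genT_eq_toGen cell hS c) hW
  have hs : (∑ e ∈ (Pd.genT c).events, sharpT sB sR ((shape ∘ Prod.fst) e)) =
      ∑ e ∈ (Pd.genT c).events, sharpT sB sR e.1 :=
    Finset.sum_congr rfl fun e _ => sharpT_shape e.1
  rw [hs] at hb
  exact hb

variable {d : ℕ} {ι γ' δ : Type*} [DecidableEq γ'] [DecidableEq δ]

/-- **M2-B's LIVE PRODUCT OF A TERM ≤ THE KEY FAMILY's `LIVEOf` AT THE SHARP TABLE** (pass-V currency, any input family
`Φ`): under `FactorRead fB fR sB sR`, members well formed for the table `dictWT Prod.fst R C.n₁`, and distinct root cells,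
`∏_{x ∈ histV.comp K} e^{lifeCost}·e^{birthWT u}·evProd fB fR (pedMV.toPGen id (K,x)) ≤ LIVEOf C K R u (sharpT sB sR)
(kmemOf Φ.pedV Φ.liveCV cellOf phys K τ)` — the one-sided key reading `hFcM` of part 2, discharged (termwise
`evProd ≤ e^{−credits sharpT}`, then module B′'s `prod_liveC_liveSharp_le_LIVEOf`). [folklore] -/
theorem live_le_LIVEOf {fB : ℕ → ℕ → Lab d → ℝ} (hF : FactorRead fB fR sB sR) (Φ : InputFamily d ι)
    (C : T4PrintedShapeBanking.Consts) {R : ℕ → ℕ} (u : ℕ → ℝ) (cellOf : ℕ → ι → ℕ × Lab d → γ')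
    (phys : ℕ → ι → ℕ × Lab d → δ) {K : ℕ} {τ : ι}
    (hWF : ∀ c ∈ Φ.liveCV K τ, ((Φ.pedV K τ).genT c).WF (dictWT Prod.fst R C.n₁))
    (hinj : Set.InjOn (cellOf K τ) (Φ.liveCV K τ : Set (ℕ × Lab d))) :
    ∏ x ∈ (Φ.run K τ).histV.comp K,
        Real.exp (lifeCost (dictWT Prod.fst R C.n₁) (costT Prod.fst C K R) ((Φ.run K τ).pedMV.genT (K, x))) *
          Real.exp (birthWT Prod.fst u ((Φ.run K τ).pedMV.genT (K, x))) *
          evProd fB fR ((Φ.run K τ).pedMV.toPGen id (K, x)) ≤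
      LIVEOf C K R u (sharpT sB sR) (kmemOf Φ.pedV Φ.liveCV cellOf phys K τ) := by
  have hK : ∀ x ∈ (Φ.run K τ).histV.comp K, (K, x) ∈ Φ.liveCV K τ := fun x hx => Finset.mem_image_of_mem _ hx
  calc ∏ x ∈ (Φ.run K τ).histV.comp K,
        Real.exp (lifeCost (dictWT Prod.fst R C.n₁) (costT Prod.fst C K R) ((Φ.run K τ).pedMV.genT (K, x))) *
          Real.exp (birthWT Prod.fst u ((Φ.run K τ).pedMV.genT (K, x))) *
          evProd fB fR ((Φ.run K τ).pedMV.toPGen id (K, x))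
      ≤ ∏ x ∈ (Φ.run K τ).histV.comp K, liveSharp Prod.fst C K R u (sharpT sB sR) ((Φ.pedV K τ).genT (K, x)) :=
        Finset.prod_le_prod (fun x _ => mul_nonneg (mul_nonneg (Real.exp_pos _).le (Real.exp_pos _).le)
          (evProd_nonneg hF.fB_nonneg hF.fR_nonneg _)) fun x hx =>
          mul_le_mul_of_nonneg_left (evProd_toPGen_le_exp_neg_credits hF (Φ.pedV K τ) id
            RunInputM.renew_step_pedMV (K, x) (hWF _ (hK x hx)))
            (mul_nonneg (Real.exp_pos _).le (Real.exp_pos _).le)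
    _ = ∏ c ∈ Φ.liveCV K τ, liveSharp Prod.fst C K R u (sharpT sB sR) ((Φ.pedV K τ).genT c) :=
        (Finset.prod_image (g := Prod.mk K) (f := fun c => liveSharp Prod.fst C K R u (sharpT sB sR) ((Φ.pedV K τ).genT c))
          fun x _ y _ h => (Prod.mk.inj h).2).symm
    _ ≤ _ := prod_liveC_liveSharp_le_LIVEOf (ped := Φ.pedV) (liveC := Φ.liveCV) (phys := phys) hinj hWF

end Live

/-! ## §2 The fields of the VS-witness from M2-B's reading with the crew's letters: `upM`, `FM_nonneg`, `priceM`, `resumM` -/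

section Fields

variable {DomK : ℕ → Type*} {I : (K : ℕ) → HIndex (DomK K)} {d : ℕ} {X : ℕ → Type*}
  {𝒢 : (K : ℕ) → GoodClass (X K)} {γ δ : Type*} [DecidableEq γ] [DecidableEq δ]

/-- members of the pass-V family of a reading are well formed for the run's table (S20 `wf_genT_pedMV`, per term)
[folklore] -/
theorem wf_genT_pedV_inputOf (ℛ : HistReading I d) {C : T4PrintedShapeBanking.Consts} {K : ℕ} {τ : HIndex.Idx I}
    (hN : (ℛ.inputOf.run K τ).NewOK) (hRm : ∀ t k, (ℛ.inputOf.run K τ).Rm t k ≤ (ℛ.inputOf.run K τ).R t)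
    (hRmS : ∀ t k, (ℛ.inputOf.run K τ).Rm t (k + 1) ≤ (ℛ.inputOf.run K τ).R (t + 1))
    (hRm2 : ∀ t, 2 ≤ (ℛ.inputOf.run K τ).Rm t 1) (hD : (ℛ.inputOf.run K τ).NewDisjoint) (hL0 : 0 < ℛ.L)
    (hL4 : 4 ≤ ℛ.L) (hdrop : ∀ m, DropCtl (ℛ.s K) m) (hR1 : ∀ t, 1 ≤ ℛ.R K t) (hn₁ : 13 ≤ C.n₁) :
    ∀ c ∈ ℛ.inputOf.liveCV K τ, ((ℛ.inputOf.pedV K τ).genT c).WF (dictWT Prod.fst (ℛ.R K) C.n₁) := by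
  intro c hc
  obtain ⟨x, hx, rfl⟩ := Finset.mem_image.1 hc
  exact wf_genT_pedMV hN hRm hRmS hRm2 hD hL0 hL4 hdrop hR1 hn₁ hx

/-- … and `ConsistentTLE` for the run's sizes (S21 `consistentTLE_genT_pedMV`, per term) [folklore] -/
theorem consistentTLE_genT_pedV_inputOf (ℛ : HistReading I d) (C : T4PrintedShapeBanking.Consts) {K : ℕ}
    {τ : HIndex.Idx I} (hN : (ℛ.inputOf.run K τ).NewOK)
    (hRm : ∀ t k, (ℛ.inputOf.run K τ).Rm t k ≤ (ℛ.inputOf.run K τ).R t)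
    (hRmS : ∀ t k, (ℛ.inputOf.run K τ).Rm t (k + 1) ≤ (ℛ.inputOf.run K τ).R (t + 1))
    (hRm2 : ∀ t, 2 ≤ (ℛ.inputOf.run K τ).Rm t 1) (hD : (ℛ.inputOf.run K τ).NewDisjoint) (hL0 : 0 < ℛ.L)
    (hL4 : 4 ≤ ℛ.L) (hdrop : ∀ m, DropCtl (ℛ.s K) m) (hR1 : ∀ t, 1 ≤ ℛ.R K t) (hn₁ : 13 ≤ C.n₁) :
    ∀ c ∈ ℛ.inputOf.liveCV K τ, ConsistentTLE Prod.fst C K (ℛ.R K) ((ℛ.inputOf.pedV K τ).genT c) := by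
  intro c hc
  obtain ⟨x, hx, rfl⟩ := Finset.mem_image.1 hc
  exact consistentTLE_genT_pedMV hN hRm hRmS hRm2 hD hL0 hL4 hdrop hR1 hn₁ hx

/-- **`upM` OF THE VS-WITNESS AT `FcM K := LIVEOf C K (ℛ.R K) (uV K) (sharpT sB sR)`** — part 2's `upM_of_reading` with
its one-sided key reading DISCHARGED by `live_le_LIVEOf` (no abstract letter left; `uV K n := 2^{d+3}·log Λ K n`).
[folklore] -/
theorem upM_of_reading' [∀ K, MeasurableSpace (X K)] (ℛ : HistReading I d) (Φf : HistFactors I d)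
    (μ : (K : ℕ) → Measure (X K)) [∀ K, IsFiniteMeasure (μ K)] (Rp : (K : ℕ) → ℝ → Repr172R (𝒢 K) (I K))
    {l₀ : ℝ} {K₀ : ℕ} (hR : HistRead ℛ Φf Rp l₀ K₀) {K : ℕ} (hK : K₀ ≤ K) {t : ℝ} (ht : |t| ≤ l₀)
    (hN : ∀ τ ∈ HIndex.termSet I K, (ℛ.inputOf.run K τ).NewOK)
    (hRm : ∀ τ ∈ HIndex.termSet I K, ∀ t k, (ℛ.inputOf.run K τ).Rm t k ≤ (ℛ.inputOf.run K τ).R t)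
    (hRmS : ∀ τ ∈ HIndex.termSet I K, ∀ t k, (ℛ.inputOf.run K τ).Rm t (k + 1) ≤ (ℛ.inputOf.run K τ).R (t + 1))
    (hRm2 : ∀ τ ∈ HIndex.termSet I K, ∀ t, 2 ≤ (ℛ.inputOf.run K τ).Rm t 1)
    (hD : ∀ τ ∈ HIndex.termSet I K, (ℛ.inputOf.run K τ).NewDisjoint)
    (hL0 : 0 < ℛ.L) (hL4 : 4 ≤ ℛ.L) (hdrop : ∀ m, DropCtl (ℛ.s K) m) (hR1 : ∀ t, 1 ≤ ℛ.R K t)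
    {C : T4PrintedShapeBanking.Consts} (hn₁ : 13 ≤ C.n₁) (hE₂ : 0 ≤ C.E₂) (hE₃ : 0 ≤ C.E₃) {Lu : ℝ} (hLu0 : 0 < Lu)
    {j : ℕ} (hj1 : 1 ≤ j) (hLu : ∀ t i, i ≤ j → Real.log (Φf.Λ K (t + i)) ≤ Lu * Real.log (Φf.Λ K t))
    (hsmall : (1122 : ℝ) ^ d * 16 * 21 ^ d * Lu ≤ 2 ^ j / 2)
    (huΦ : ∀ t, t ≤ K → Real.log (Φf.Λ K t) * (6 * (561 ^ d * j * Lu + 1122 ^ d * Lu)) ≤ floorK C K (ℛ.R K) t)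
    (huE₂ : ∀ n, n ≤ K → Real.log (Φf.Λ K n) * (15 * 126 ^ d) ≤ C.E₂ * (ℛ.R K n : ℝ) ^ C.q')
    (huE₃ : ∀ n, n ≤ K → Real.log (Φf.Λ K n) * (24 * 126 ^ d) ≤ C.E₃ * (ℛ.R K n : ℝ) ^ C.q')
    {sB : ℕ → ℕ → ℝ} {sR : ℕ → ℝ} (hF : FactorRead (Φf.fB K) (Φf.fR K) sB sR) {W : ℕ → ℝ} (hW : 0 < W K)
    (cellOf : ℕ → HIndex.Idx I → ℕ × Lab d → γ) (phys : ℕ → HIndex.Idx I → ℕ × Lab d → δ)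
    (hinj : ∀ τ ∈ HIndex.termSet I K, Set.InjOn (cellOf K τ) (ℛ.inputOf.liveCV K τ : Set (ℕ × Lab d)))
    (jstar : ℕ → ℕ) :
    ∀ k ∈ badGMems (memOf ℛ.inputOf.pedV ℛ.inputOf.liveCV cellOf) jstar (HIndex.termSet I)
        (kmemOf ℛ.inputOf.pedV ℛ.inputOf.liveCV cellOf phys) K,
      ∀ τ ∈ fibre (kmemOf ℛ.inputOf.pedV ℛ.inputOf.liveCV cellOf phys) (HIndex.termSet I) K k,
        Repr172R.weight μ Rp t τ ≤
          deadOf ℛ Φf W K t τ *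
            LIVEOf C K (ℛ.R K) (fun n => 2 ^ (d + 3) * Real.log (Φf.Λ K n)) (sharpT sB sR) k *
            nupOf Φf (fun K => (μ K).real Set.univ) W K t :=
  upM_of_reading ℛ Φf μ Rp hR hK ht hN hRm hRmS hRm2 hD hL0 hL4 hdrop hR1 hn₁ hE₂ hE₃ hLu0 hj1 hLu hsmall huΦ huE₂
    huE₃ hF.fB_nonneg hF.fR_nonneg hW cellOf phys jstar
    (FcM := fun K k => LIVEOf C K (ℛ.R K) (fun n => 2 ^ (d + 3) * Real.log (Φf.Λ K n)) (sharpT sB sR) k)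
    fun τ hτ => live_le_LIVEOf hF ℛ.inputOf C _ cellOf phys
      (wf_genT_pedV_inputOf ℛ (hN τ hτ) (hRm τ hτ) (hRmS τ hτ) (hRm2 τ hτ) (hD τ hτ) hL0 hL4 hdrop hR1 hn₁) (hinj τ hτ)

/-- **`FM_nonneg` OF THE VS-WITNESS AT `FcM := LIVEOf`**: the key family's live product is nonnegative (positive).
[folklore] -/
theorem FM_nonneg_of_reading (ℛ : HistReading I d) (C : T4PrintedShapeBanking.Consts) (K : ℕ) (R : ℕ → ℕ)
    (u : ℕ → ℝ) (σ : PEv → ℝ) (cellOf : ℕ → HIndex.Idx I → ℕ × Lab d → γ)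
    (phys : ℕ → HIndex.Idx I → ℕ × Lab d → δ) (jstar : ℕ → ℕ) :
    ∀ k ∈ badGMems (memOf ℛ.inputOf.pedV ℛ.inputOf.liveCV cellOf) jstar (HIndex.termSet I)
        (kmemOf ℛ.inputOf.pedV ℛ.inputOf.liveCV cellOf phys) K, 0 ≤ LIVEOf C K R u σ k :=
  fun k _ => (LIVEOf_pos C K R u σ k).le

/-- **`priceM` OF THE VS-WITNESS, SUPPLIED FROM THE READING** (IR-46-1 (B) «`priceM_of_reading` := B ∘ owner»): at a
cutoff `K ≥ K₀` and `|t| ≤ l₀` (unused — the sentence is source-free), for every bad term `τ` of `termSet I K`, with the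
pass-V process conditions per term, (2.9) on the run's sizes, `1 ≤ L`, `0 < E₂`, `0 ≤ E₃`, `13 ≤ n₁`, the factor
reading `FactorRead (fB K) (fR K) sB sR` with the booked junction `RoundingRoomF C O L K (ℛ.R K) g sB sR φB φR`, and
distinct root cells:
`LIVEOf C K (ℛ.R K) (uV K) (sharpT sB sR) (kmemOf …) * MULTOf (sharpT φB φR) (kmemOf …) ≤ ∏_{q ∈ memOf … K τ}
pshapeTH Prod.fst O C 1 1 (ℛ.R K) g 0 (costT …) q.2 · e^{birthWT Prod.fst (uV K) q.2} · e^{−(8∕E₂·totalCostT … + 4·partnerAges …)}`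
— the field `priceM` at `FcM := LIVEOf`, `RfM := MULTOf`, literally (module B′'s `priceM_of_keys_of_charge` with the
charge from §1 and the members' `WF` ∕ `ConsistentTLE` from S20∕S21). [folklore] -/
theorem priceM_of_reading (ℛ : HistReading I d) (Φf : HistFactors I d) {K : ℕ}
    (hN : ∀ τ ∈ HIndex.termSet I K, (ℛ.inputOf.run K τ).NewOK)
    (hRm : ∀ τ ∈ HIndex.termSet I K, ∀ t k, (ℛ.inputOf.run K τ).Rm t k ≤ (ℛ.inputOf.run K τ).R t)
    (hRmS : ∀ τ ∈ HIndex.termSet I K, ∀ t k, (ℛ.inputOf.run K τ).Rm t (k + 1) ≤ (ℛ.inputOf.run K τ).R (t + 1))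
    (hRm2 : ∀ τ ∈ HIndex.termSet I K, ∀ t, 2 ≤ (ℛ.inputOf.run K τ).Rm t 1)
    (hD : ∀ τ ∈ HIndex.termSet I K, (ℛ.inputOf.run K τ).NewDisjoint)
    (hL0 : 0 < ℛ.L) (hL4 : 4 ≤ ℛ.L) (hdrop : ∀ m, DropCtl (ℛ.s K) m) (hR1 : ∀ t, 1 ≤ ℛ.R K t)
    {C : T4PrintedShapeBanking.Consts} (hn₁ : 13 ≤ C.n₁) (hE₂ : 0 < C.E₂) (hE₃ : 0 ≤ C.E₃)
    {O : PrintedO1s} {g : ℕ → ℝ} {L : ℕ} {β' β₀ : ℝ} {sB φB : ℕ → ℕ → ℝ} {sR φR : ℕ → ℝ}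
    (hRR : RoundingRoomF C O L K (ℛ.R K) g sB sR φB φR) (h29 : B14FlowStep.FlowIneq29 (ℛ.R K) g L β' β₀ K)
    (hL1 : 1 ≤ L)
    (cellOf : ℕ → HIndex.Idx I → ℕ × Lab d → γ) (phys : ℕ → HIndex.Idx I → ℕ × Lab d → δ)
    (hinj : ∀ τ ∈ HIndex.termSet I K, Set.InjOn (cellOf K τ) (ℛ.inputOf.liveCV K τ : Set (ℕ × Lab d)))
    (jstar : ℕ → ℕ) :
    ∀ τ ∈ badTerms (memOf ℛ.inputOf.pedV ℛ.inputOf.liveCV cellOf) jstar (HIndex.termSet I) K,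
      LIVEOf C K (ℛ.R K) (fun n => 2 ^ (d + 3) * Real.log (Φf.Λ K n)) (sharpT sB sR)
            (kmemOf ℛ.inputOf.pedV ℛ.inputOf.liveCV cellOf phys K τ) *
          MULTOf (sharpT φB φR) (kmemOf ℛ.inputOf.pedV ℛ.inputOf.liveCV cellOf phys K τ) ≤
        ∏ q ∈ memOf ℛ.inputOf.pedV ℛ.inputOf.liveCV cellOf K τ,
          pshapeTH Prod.fst O C 1 1 (ℛ.R K) g 0 (costT Prod.fst C K (ℛ.R K)) q.2 *
            Real.exp (birthWT Prod.fst (fun n => 2 ^ (d + 3) * Real.log (Φf.Λ K n)) q.2) *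
            Real.exp (-(8 / C.E₂ * totalCostT Prod.fst C K (ℛ.R K) q.2 +
              4 * (partnerAges (PEv.step ∘ Prod.fst) q.2 : ℝ))) := by
  intro τ hτ
  have hτT : τ ∈ HIndex.termSet I K := (mem_badTerms.1 hτ).1
  have hWF := wf_genT_pedV_inputOf ℛ (C := C) (hN τ hτT) (hRm τ hτT) (hRmS τ hτT) (hRm2 τ hτT) (hD τ hτT) hL0 hL4
    hdrop hR1 hn₁
  have hCT := consistentTLE_genT_pedV_inputOf ℛ C (hN τ hτT) (hRm τ hτT) (hRmS τ hτT) (hRm2 τ hτT) (hD τ hτT) hL0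
    hL4 hdrop hR1 hn₁
  exact priceM_of_keys_of_charge (hinj τ hτT) hWF fun c hc =>
    credits_add_discount_add_fshare_le_sharps h29 hL1 hE₂ hE₃ hRR (hWF c hc) (hCT c hc)

/-- **`resumM` OF THE VS-WITNESS AT `RfM K := MULTOf (sharpT (φB K) (φR K))` FROM THE LOCATED DISPLAY (ρ) `FibreMass`**
(part 2's `resumM_of_fibreMass`, instantiated). [folklore] -/
theorem resumM_of_reading (ℛ : HistReading I d) (Φf : HistFactors I d) {K : ℕ} {W : ℕ → ℝ} (hW : 0 < W K) (t : ℝ)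
    (cellOf : ℕ → HIndex.Idx I → ℕ × Lab d → γ) (phys : ℕ → HIndex.Idx I → ℕ × Lab d → δ) (jstar : ℕ → ℕ)
    (φB : ℕ → ℕ → ℝ) (φR : ℕ → ℝ)
    (hρ : ∀ k ∈ badGMems (memOf ℛ.inputOf.pedV ℛ.inputOf.liveCV cellOf) jstar (HIndex.termSet I)
        (kmemOf ℛ.inputOf.pedV ℛ.inputOf.liveCV cellOf phys) K,
      ∑ τ ∈ fibre (kmemOf ℛ.inputOf.pedV ℛ.inputOf.liveCV cellOf phys) (HIndex.termSet I) K k,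
        dmassOf ℛ Φf t τ ≤ W K * MULTOf (sharpT φB φR) k) :
    ∀ k ∈ badGMems (memOf ℛ.inputOf.pedV ℛ.inputOf.liveCV cellOf) jstar (HIndex.termSet I)
        (kmemOf ℛ.inputOf.pedV ℛ.inputOf.liveCV cellOf phys) K,
      ∑ τ ∈ fibre (kmemOf ℛ.inputOf.pedV ℛ.inputOf.liveCV cellOf phys) (HIndex.termSet I) K k,
        deadOf ℛ Φf W K t τ ≤ MULTOf (sharpT φB φR) k :=
  resumM_of_fibreMass ℛ Φf hW t cellOf phys jstar (MULT := fun _ k => MULTOf (sharpT φB φR) k) hρ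

end Fields

end

end Summit.QuantumFields.BalabanUV.T4Continuum.HistoryRealiseCellsRunSupplyKeysWTVS
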